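import Summits.AnomalousDissipation.AnomalousDissipation.Theorems.SolenoidalFractalHomogenisationRealisedQuasiStaticCellLawInPlaneFrame
import Literature.Analysis.FluidPDE.LatticeShearWords
import Literature.Analysis.FunctionSpaces.TorusPeriodicLocalization
import HarnessLib

/-!
# K2R `RealisedQuasiStaticCellLaw`, line `floquet-bloch`, stub `stub_lowSectorDecay` (S1D): the slot gain in the slot's
# own polarisation frame (W-near isotropy input)

Summits-side helper file (everything proved; no definitions, no named facts; `--supports stmt-AnomalousDissipation-20446`).
For a unit large-scale direction `q`, a unit polarisation `p ⊥ q`, and the slot frame `ζ ⊥ q, m` (out of plane),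
`η = q × ζ` (in plane): the polarisation factor of `slotGain` splits as
`‖p‖² − ⟪p, m_p⟫² = (ζ·p)² + (m̂·q)²(η·p)²` (`polarisation_factor`, `slotGain_frame`) — out-of-plane weight `1`, in-plane
weight `(m̂·q)²`, exactly the nominal slaved weights `σ_o/2`, `σ_i/2` of the two ladders in the limit `n → ∞`. Summed over the
cubature word with `IsotropicWordGain` this is the isotropy of the nominal slow exponents used by `comoving_transport_lower`.
-/

set_option linter.dupNamespace false

noncomputable section

namespace Summit.AnomalousDissipation.AnomalousDissipation.Theorems.SolenoidalFractalHomogenisation.RealisedQuasiStaticCellLaw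

open Matrix
open scoped Matrix InnerProductSpace RealInnerProductSpace
open Literature.Analysis Literature.Analysis.FunctionSpaces Literature.Analysis.FunctionSpaces.Torus
open Literature.Analysis.FluidPDE Literature.Analysis.FluidPDE.LatticeShear

/-- **Polarisation factor in the slot frame** (vector algebra in `ℝ³`): for an orthonormal pair `e₁ ⊥ e₃`, a vector `x ⊥ e₃`
and a unit `m ⊥ e₁`: `x·x − (x·(m − (m·e₃)e₃))² = (e₁·x)² + (m·e₃)²((e₃ × e₁)·x)²`. -/
theorem polarisation_factor (e1 e3 x m : Fin 3 → ℝ) (h11 : e1 ⬝ᵥ e1 = 1) (h33 : e3 ⬝ᵥ e3 = 1) (h31 : e3 ⬝ᵥ e1 = 0)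
    (hx3 : x ⬝ᵥ e3 = 0) (hm1 : m ⬝ᵥ e1 = 0) (hmm : m ⬝ᵥ m = 1) :
    x ⬝ᵥ x - (x ⬝ᵥ (m - (m ⬝ᵥ e3) • e3)) ^ 2 =
      (e1 ⬝ᵥ x) ^ 2 + (m ⬝ᵥ e3) ^ 2 * ((e3 ⨯₃ e1) ⬝ᵥ x) ^ 2 := by
  have h22 := frame_e2_dot_e2 e1 e3 h11 h33 h31
  have h12 : e1 ⬝ᵥ (e3 ⨯₃ e1) = 0 := dot_cross_self _ _
  have h32 : e3 ⬝ᵥ (e3 ⨯₃ e1) = 0 := dot_self_cross _ _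
  have hexp := frame_expansion e1 e3 x h11 h33 h31 hx3
  -- |x|² in the frame
  have hxx : x ⬝ᵥ x = (e1 ⬝ᵥ x) ^ 2 + ((e3 ⨯₃ e1) ⬝ᵥ x) ^ 2 := by
    have h2 : x ⬝ᵥ x = x ⬝ᵥ ((e1 ⬝ᵥ x) • e1 + ((e3 ⨯₃ e1) ⬝ᵥ x) • (e3 ⨯₃ e1)) := by rw [← hexp]
    rw [dotProduct_add, dotProduct_smul, dotProduct_smul, smul_eq_mul, smul_eq_mul, dotProduct_comm x e1,
      dotProduct_comm x (e3 ⨯₃ e1)] at h2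
    rw [h2]; ring
  -- x·(m − c e₃) = (η·x)(η·m)
  have hxm : x ⬝ᵥ (m - (m ⬝ᵥ e3) • e3) = ((e3 ⨯₃ e1) ⬝ᵥ x) * ((e3 ⨯₃ e1) ⬝ᵥ m) := by
    rw [dotProduct_sub, dotProduct_smul, hx3, smul_eq_mul, mul_zero, sub_zero]
    have h2 : x ⬝ᵥ m = ((e1 ⬝ᵥ x) • e1 + ((e3 ⨯₃ e1) ⬝ᵥ x) • (e3 ⨯₃ e1)) ⬝ᵥ m := by rw [← hexp]
    rw [h2, add_dotProduct, smul_dotProduct, smul_dotProduct, smul_eq_mul, smul_eq_mul, dotProduct_comm e1 m, hm1,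
      mul_zero, zero_add]
  -- (η·m)² = 1 − c²
  have hy3 : (m - (m ⬝ᵥ e3) • e3) ⬝ᵥ e3 = 0 := by
    rw [sub_dotProduct, smul_dotProduct, h33, smul_eq_mul, mul_one, dotProduct_comm m e3, sub_self]
  have hyexp := frame_expansion e1 e3 (m - (m ⬝ᵥ e3) • e3) h11 h33 h31 hy3
  have hy1 : e1 ⬝ᵥ (m - (m ⬝ᵥ e3) • e3) = 0 := by
    rw [dotProduct_sub, dotProduct_smul, dotProduct_comm e1 m, hm1, dotProduct_comm e1 e3, h31, smul_zero, sub_zero]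
  have hy2 : (e3 ⨯₃ e1) ⬝ᵥ (m - (m ⬝ᵥ e3) • e3) = (e3 ⨯₃ e1) ⬝ᵥ m := by
    rw [dotProduct_sub, dotProduct_smul, dotProduct_comm (e3 ⨯₃ e1) e3, h32, smul_zero, sub_zero]
  rw [hy1, zero_smul, zero_add, hy2] at hyexp
  have hyy : (m - (m ⬝ᵥ e3) • e3) ⬝ᵥ (m - (m ⬝ᵥ e3) • e3) = 1 - (m ⬝ᵥ e3) ^ 2 := by
    rw [sub_dotProduct, dotProduct_sub, dotProduct_sub, smul_dotProduct, dotProduct_smul, dotProduct_smul,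
      smul_dotProduct, hmm, h33, dotProduct_comm e3 m]
    simp only [smul_eq_mul]
    ring
  have hyy' : (m - (m ⬝ᵥ e3) • e3) ⬝ᵥ (m - (m ⬝ᵥ e3) • e3) = ((e3 ⨯₃ e1) ⬝ᵥ m) ^ 2 := by
    conv_lhs => rw [hyexp]
    rw [smul_dotProduct, dotProduct_smul, h22, smul_eq_mul, smul_eq_mul]; ring
  have hηm : ((e3 ⨯₃ e1) ⬝ᵥ m) ^ 2 = 1 - (m ⬝ᵥ e3) ^ 2 := by rw [← hyy', hyy]
  rw [hxx, hxm, mul_pow, hηm]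
  ring

/-- **The slot gain in the slot frame.** For a lattice phase `(m, ê)`, a unit direction `q`, a unit polarisation `p ⊥ q`
and a real unit `ζ ⊥ q, m`: `slotGain(q,p) = τ/(2(2π|m|)⁴)·⟪ê,q⟫²·((ζ·p)² + ⟪m̂,q⟫²((q × ζ)·p)²)`. -/
theorem slotGain_frame (P : LatticePhase) (q p : EuclideanSpace ℝ (Fin 3)) (hq : ‖q‖ = 1) (hpq : ⟪p, q⟫_ℝ = 0)
    {ζ : Fin 3 → ℝ} (hζ1 : ζ ⬝ᵥ ζ = 1) (hζq : ζ ⬝ᵥ WithLp.ofLp q = 0)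
    (hζm : ζ ⬝ᵥ WithLp.ofLp (latticeVec P.m) = 0) :
    slotGain P q p = P.τ * (1 / (2 * (2 * Real.pi * ‖latticeVec P.m‖) ^ 4)) * ⟪P.e, q⟫_ℝ ^ 2 *
      ((ζ ⬝ᵥ WithLp.ofLp p) ^ 2 + ⟪(1 / ‖latticeVec P.m‖) • latticeVec P.m, q⟫_ℝ ^ 2 *
        ((WithLp.ofLp q ⨯₃ ζ) ⬝ᵥ WithLp.ofLp p) ^ 2) := by
  have hmv : 0 < ‖latticeVec P.m‖ := lt_of_lt_of_le one_pos (one_le_norm_latticeVec P.m_ne)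
  -- the dot-product dictionary
  have hinner : ∀ a b : EuclideanSpace ℝ (Fin 3), ⟪a, b⟫_ℝ = WithLp.ofLp a ⬝ᵥ WithLp.ofLp b := by
    intro a b
    rw [EuclideanSpace.inner_eq_star_dotProduct, star_trivial, dotProduct_comm]
  set e3 : Fin 3 → ℝ := WithLp.ofLp q with he3
  set x : Fin 3 → ℝ := WithLp.ofLp p with hx
  set mh : Fin 3 → ℝ := WithLp.ofLp ((1 / ‖latticeVec P.m‖) • latticeVec P.m) with hmh
  have h33 : e3 ⬝ᵥ e3 = 1 := by
    rw [he3, ← hinner, real_inner_self_eq_norm_sq, hq]; norm_num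
  have h31 : e3 ⬝ᵥ ζ = 0 := by rw [dotProduct_comm]; exact hζq
  have hx3 : x ⬝ᵥ e3 = 0 := by rw [hx, he3, ← hinner]; exact hpq
  have hmh' : mh = (1 / ‖latticeVec P.m‖) • WithLp.ofLp (latticeVec P.m) := by rw [hmh, WithLp.ofLp_smul]
  have hm1 : mh ⬝ᵥ ζ = 0 := by rw [hmh', smul_dotProduct, dotProduct_comm, hζm, smul_zero]
  have hmm : mh ⬝ᵥ mh = 1 := by
    rw [hmh, ← hinner, real_inner_self_eq_norm_sq, norm_smul, Real.norm_eq_abs, abs_of_pos (by positivity)]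
    field_simp
  have hpol := polarisation_factor ζ e3 x mh hζ1 h33 h31 hx3 hm1 hmm
  -- unfold the slot gain
  show P.τ * (1 / (2 * (2 * Real.pi * ‖latticeVec P.m‖) ^ 4)) * ⟪P.e, q⟫_ℝ ^ 2 *
      (‖p‖ ^ 2 - ⟪p, (1 / ‖latticeVec P.m‖) • latticeVec P.m -
        ⟪(1 / ‖latticeVec P.m‖) • latticeVec P.m, q⟫_ℝ • q⟫_ℝ ^ 2) = _
  congr 1
  have e1 : ‖p‖ ^ 2 = x ⬝ᵥ x := by rw [← real_inner_self_eq_norm_sq, hinner]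
  have e2 : ⟪p, (1 / ‖latticeVec P.m‖) • latticeVec P.m - ⟪(1 / ‖latticeVec P.m‖) • latticeVec P.m, q⟫_ℝ • q⟫_ℝ =
      x ⬝ᵥ (mh - (mh ⬝ᵥ e3) • e3) := by
    rw [hinner, hinner, WithLp.ofLp_sub, WithLp.ofLp_smul, WithLp.ofLp_smul, ← hmh']
  have e3' : ⟪(1 / ‖latticeVec P.m‖) • latticeVec P.m, q⟫_ℝ = mh ⬝ᵥ e3 := by rw [hinner]
  rw [e1, e2, e3', hpol]

end Summit.AnomalousDissipation.AnomalousDissipation.Theorems.SolenoidalFractalHomogenisation.RealisedQuasiStaticCellLaw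

end
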